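import Mathlib
import Summits.ValiantsHypothesis.ValiantsHypothesis.Theorems.BarrierLeverDefinableEquationsProductDepthWallUniversalPrelims

/-!
# Route BarrierLever — crux `DefinableEquations` (stmt-8745) / item `SingleSizeEquations`
# (stmt-8749): an LST-UNIVERSAL small circuit — ONE polynomial of complexity `≤ 5n⁴` with FULL
# block rank for EVERY word datum at once (the LST wall for UNION certificates; val-np-p5 g10; part 2 of 2,
# tools in `…ProductDepthWallUniversalPrelims.lean`)

`…ProductDepthWall.lean` kills the LST class condition datum by datum: for each word datum
`w = (k, pos, d, e)` the placed word polynomial `e_*(P_w) ∈ SmallCircuits ℂ n 5` has full block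
rank.  A UNION certificate — "every `f` in the class has SOME deficient datum `w ∈ W`" (the way
Raz's full-rank method unites all balanced cuts) — needs one member of the class that is full for
ALL data simultaneously.  This file provides it, by the Raz–Yehudayoff specialisation trick applied
to a GENERIC WIDTH-`n`, LENGTH-`n` ALGEBRAIC BRANCHING PROGRAM:

**Theorem (`exists_lstUniversal_smallCircuits`).**  For every `n ≥ 5` there is ONE
`f ∈ SmallCircuits ℂ n 5` such that for EVERY word datum (`1 ≤ d ≤ n`, `k`, sign pattern `pos`,
states fitting into `Fin n`) and EVERY embedding `e` of its blocks,
`pdRank (killCompl e f) = 2^{min(|σ⁺|,|σ⁻|)}`.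

Construction: `F_A = tr (L^{(1)}(x) ⋯ L^{(n)}(x))` with `n × n` matrices of AFFINE forms
`L^{(t)}_{e e'}(x) = Σ_v A_{t,e,e',v} x_v + A_{t,e,e',∗}` — i.e. `IMM_{n,n}` composed with affine
forms (`complexity ≤ n + 2n⁴ + n³(2n+1) ≤ n⁵` for `n ≥ 5`, degree `≤ n`).  For each datum `w`, the
specialisation `A(w)` = (LST's substitution `ρ_w` placed by `e` on the first `d` layers, identity
matrices on the others) gives `F_{A(w)} = e_*(P_w)` (`aeval_immPoly_eq_trace`, padding by identity
layers, `aeval_wordSubst_immPoly`), whose block matrix has a nonzero maximal minor; that minor of the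
GENERIC `F` (coefficients in `ℂ[A]`) is therefore a nonzero polynomial in `A`; the product over the
FINITELY many data is nonzero, so one `A⋆` is good for all (`MvPolynomial.funext`), and
`rank ≥` minor size (`card_le_rank_of_det_submatrix_ne_zero`) `= 2^{min}` `≥ rank`.

Corollaries: `not_forall_exists_pdRank_lt` — no UNION-type LST class condition
("`∀ f ∈ SmallCircuits ℂ n 5, ∃ datum, pdRank < full`") holds, for any family of data whatsoever;
FSV form `not_isNaturalProof_of_zeroSet_union`.  What this is NOT: as all walls, it kills rank
THRESHOLDS (and their unions), not every polynomial in the ideals of minors; nothing on the crux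
(b = 2 OPEN) or `VP ≠ VNP`.  No definitions, no named facts, standard axioms.
Refs: Limaye–Srinivasan–Tavenas, J. ACM 72 (2025) §2.2, Lemma 8; Raz–Yehudayoff 2008 §4 (the
specialisation argument); Forbes–Shpilka–Volk 2018 Def. 1/3.
-/

-- `Summit.ValiantsHypothesis.ValiantsHypothesis.…` repeats a component by the D-0017 layout
-- (single-conjunct summit), which the `dupNamespace` linter flags; the name is mandated.
set_option linter.dupNamespace false

noncomputable section

namespace Summit.ValiantsHypothesis.ValiantsHypothesis.Theorems.BarrierLeverDefinableEquations

open MvPolynomial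
open Literature.Computability.AlgebraicComplexity
open Literature.Computability.AlgebraicComplexity.LSTWord
open Literature.Barriers.ValiantsHypothesis
open scoped BigOperators

namespace ProductDepthWallUniversal

/-! ## §1 The generic affine `IMM` and the universal specialisation -/

section Universal

/-- Specialising the coefficients of the GENERIC affine substitution (coefficients = the variables
of `ℂ[A]`) at a point `A` gives the affine substitution with coefficient tensor `A`. [folklore] -/
theorem mapAlgHom_aeval_generic {n : ℕ} (A : (Fin n × Fin n × Fin n) × Option (Fin n) → ℂ) :
    MvPolynomial.mapAlgHom (σ := Fin n) (MvPolynomial.aeval A)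
        (aeval (fun v : Fin n × Fin n × Fin n =>
          (∑ u : Fin n, C (X (v, some u)) * X u + C (X (v, none)) :
            MvPolynomial (Fin n) (MvPolynomial ((Fin n × Fin n × Fin n) × Option (Fin n)) ℂ)))
          (immPoly n n ℂ)) =
      aeval (fun v : Fin n × Fin n × Fin n =>
        (∑ u : Fin n, C (A (v, some u)) * X u + C (A (v, none)) : MvPolynomial (Fin n) ℂ))
        (immPoly n n ℂ) := by
  rw [comp_aeval_apply]
  have hpt : ∀ v : Fin n × Fin n × Fin n,
      MvPolynomial.mapAlgHom (σ := Fin n) (MvPolynomial.aeval A)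
        (∑ u : Fin n, C (X (v, some u)) * X u + C (X (v, none)) :
          MvPolynomial (Fin n) (MvPolynomial ((Fin n × Fin n × Fin n) × Option (Fin n)) ℂ)) =
      (∑ u : Fin n, C (A (v, some u)) * X u + C (A (v, none)) : MvPolynomial (Fin n) ℂ) := by
    intro v
    simp only [mapAlgHom_apply, map_add, map_sum, map_mul, map_C, map_X, RingHom.coe_coe, aeval_X]
  simp only [hpt]

/-- Coefficients commute with the specialisation. [folklore] -/
theorem coeff_mapAlgHom_aeval {n : ℕ} (A : (Fin n × Fin n × Fin n) × Option (Fin n) → ℂ)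
    (G : MvPolynomial (Fin n) (MvPolynomial ((Fin n × Fin n × Fin n) × Option (Fin n)) ℂ))
    (m : Fin n →₀ ℕ) :
    coeff m (MvPolynomial.mapAlgHom (σ := Fin n) (MvPolynomial.aeval A) G) =
      MvPolynomial.aeval A (coeff m G) := by
  rw [mapAlgHom_apply, coeff_map, RingHom.coe_coe]

/-- **The LST-universal small circuit.**  For every `n` there is ONE polynomial
`f ∈ ℂ[x_1, …, x_n]` of degree `≤ n` and complexity `≤ n + 2n⁴ + n³(2n+1)` — a width-`n`,
length-`n` algebraic branching program with affine edge labels — such that for EVERY word datum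
(`1 ≤ d ≤ n`, `k ≤ n`, states fitting into `Fin n`) and EVERY embedding `e` of its blocks the
block coefficient matrix of `f` has FULL rank `2^{min(|σ⁺|,|σ⁻|)}`.
[cite: LimayeSrinivasanTavenas2025, §2.2 and Lemma 8] [cite: RazYehudayoff2008, §4 (specialisation)] -/
theorem exists_lstUniversal (n : ℕ) :
    ∃ f : MvPolynomial (Fin n) ℂ, f.totalDegree ≤ n ∧
      complexity f ≤ n + 2 * n ^ 3 * n + n ^ 3 * (2 * n + 1) ∧
      ∀ {d : ℕ} (k : ℕ) (pos : Fin d → Bool), 1 ≤ d → d ≤ n → k ≤ n →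
        ∀ (hn : ∀ t ≤ d, 2 ^ overLen k pos t ≤ n) (e : (Σ i : Fin d, BlockVar k pos i) ↪ Fin n),
        pdRank ℂ (posBlocks pos) (negBlocks pos) (killCompl e.injective f) =
          2 ^ min (streamLen k pos true d) (streamLen k pos false d) := by
  classical
  -- the generic polynomial `G` over `ℂ[A]`
  obtain ⟨G, hG⟩ : ∃ G : MvPolynomial (Fin n)
      (MvPolynomial ((Fin n × Fin n × Fin n) × Option (Fin n)) ℂ),
      G = aeval (fun v : Fin n × Fin n × Fin n =>
        (∑ u : Fin n, C (X (v, some u)) * X u + C (X (v, none)) :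
          MvPolynomial (Fin n) (MvPolynomial ((Fin n × Fin n × Fin n) × Option (Fin n)) ℂ)))
        (immPoly n n ℂ) := ⟨_, rfl⟩
  -- its specialisations
  have hspec : ∀ A : (Fin n × Fin n × Fin n) × Option (Fin n) → ℂ,
      MvPolynomial.mapAlgHom (σ := Fin n) (MvPolynomial.aeval A) G =
        aeval (fun v : Fin n × Fin n × Fin n =>
          (∑ u : Fin n, C (A (v, some u)) * X u + C (A (v, none)) : MvPolynomial (Fin n) ℂ))
          (immPoly n n ℂ) := fun A => by rw [hG]; exact mapAlgHom_aeval_generic A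
  -- for every index a nonzero polynomial in `A` detecting full block rank
  have key : ∀ (d k : Fin (n + 1)) (pos : Fin d → Bool)
      (e : (Σ i : Fin d, BlockVar k pos i) ↪ Fin n),
      ∃ Q : MvPolynomial ((Fin n × Fin n × Fin n) × Option (Fin n)) ℂ, Q ≠ 0 ∧
        ∀ A : (Fin n × Fin n × Fin n) × Option (Fin n) → ℂ, MvPolynomial.aeval A Q ≠ 0 →
          1 ≤ (d : ℕ) → (∀ t ≤ (d : ℕ), 2 ^ overLen k pos t ≤ n) →
          pdRank ℂ (posBlocks pos) (negBlocks pos) (killCompl e.injective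
            (MvPolynomial.mapAlgHom (σ := Fin n) (MvPolynomial.aeval A) G)) =
            2 ^ min (streamLen k pos true d) (streamLen k pos false d) := by
    intro d k pos e
    by_cases hgood : 1 ≤ (d : ℕ) ∧ ∀ t ≤ (d : ℕ), 2 ^ overLen k pos t ≤ n
    · obtain ⟨hd1, hn⟩ := hgood
      obtain ⟨A₀, hA₀⟩ := exists_affine_specialisation (n := n) k pos hd1 (by omega) hn e
      -- the block matrix of `e_*(P_w)` has full rank
      have hrank := BlockPlacement.pdRank_killCompl_eq_rank e (posBlocks pos) (negBlocks pos)
        (rename e (wordPoly k pos ℂ))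
      rw [killCompl_rename_app, pdRank_wordPoly] at hrank
      obtain ⟨ρ, κ, -, -, hdet⟩ :=
        Literature.LinearAlgebra.Matrix.exists_det_submatrix_ne_zero_of_le_rank _ hrank.le
      -- the same minor of the GENERIC block matrix
      refine ⟨((Matrix.of fun (rr : Assignment (BlockVar k pos) (posBlocks pos))
          (cc : Assignment (BlockVar k pos) (negBlocks pos)) =>
          coeff (Finsupp.mapDomain e (assignMonomial (posBlocks pos) rr +
            assignMonomial (negBlocks pos) cc)) G).submatrix ρ κ).det, ?_, ?_⟩
      · -- nonzero: its value at `A₀` is the nonzero minor of `e_*(P_w)`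
        intro hQ
        apply hdet
        have hev := congrArg (MvPolynomial.aeval A₀) hQ
        rw [map_zero, AlgHom.map_det] at hev
        rw [← hev]
        congr 1
        ext i j
        simp only [AlgHom.mapMatrix_apply, Matrix.map_apply, Matrix.submatrix_apply, Matrix.of_apply]
        rw [← coeff_mapAlgHom_aeval, hspec A₀, hA₀]
      · intro A hA _ _
        rw [BlockPlacement.pdRank_killCompl_eq_rank]
        apply le_antisymm
        · have h1 := Matrix.rank_le_card_height (Matrix.of
            fun (rr : Assignment (BlockVar k pos) (posBlocks pos))
              (cc : Assignment (BlockVar k pos) (negBlocks pos)) =>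
            coeff (Finsupp.mapDomain e (assignMonomial (posBlocks pos) rr +
              assignMonomial (negBlocks pos) cc))
              (MvPolynomial.mapAlgHom (σ := Fin n) (MvPolynomial.aeval A) G))
          have h2 := Matrix.rank_le_card_width (Matrix.of
            fun (rr : Assignment (BlockVar k pos) (posBlocks pos))
              (cc : Assignment (BlockVar k pos) (negBlocks pos)) =>
            coeff (Finsupp.mapDomain e (assignMonomial (posBlocks pos) rr +
              assignMonomial (negBlocks pos) cc))
              (MvPolynomial.mapAlgHom (σ := Fin n) (MvPolynomial.aeval A) G))
          rw [card_rows] at h1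
          rw [card_cols] at h2
          rcases le_total (streamLen k pos true d) (streamLen k pos false d) with hle | hle
          · rw [min_eq_left hle]; exact h1
          · rw [min_eq_right hle]; exact h2
        · have hA' : ((Matrix.of
            fun (rr : Assignment (BlockVar k pos) (posBlocks pos))
              (cc : Assignment (BlockVar k pos) (negBlocks pos)) =>
            coeff (Finsupp.mapDomain e (assignMonomial (posBlocks pos) rr +
              assignMonomial (negBlocks pos) cc))
              (MvPolynomial.mapAlgHom (σ := Fin n) (MvPolynomial.aeval A) G)).submatrix ρ κ).det
              ≠ 0 := by
            intro h0
            apply hA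
            rw [AlgHom.map_det, ← h0]
            congr 1
          simpa [Fintype.card_fin] using
            Literature.LinearAlgebra.Matrix.card_le_rank_of_det_submatrix_ne_zero _ ρ κ hA'
    · exact ⟨1, one_ne_zero, fun A _ hd1 hn => (hgood ⟨hd1, hn⟩).elim⟩
  choose Q hQ0 hQ using key
  -- one point good for all indices
  have hprod : (∏ w : (Σ d : Fin (n + 1), Σ k : Fin (n + 1), Σ pos : Fin d → Bool,
      ((Σ i : Fin d, BlockVar k pos i) ↪ Fin n)), Q w.1 w.2.1 w.2.2.1 w.2.2.2) ≠ 0 :=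
    Finset.prod_ne_zero_iff.2 fun w _ => hQ0 _ _ _ _
  obtain ⟨A, hA⟩ : ∃ A : (Fin n × Fin n × Fin n) × Option (Fin n) → ℂ,
      MvPolynomial.aeval A (∏ w : (Σ d : Fin (n + 1), Σ k : Fin (n + 1), Σ pos : Fin d → Bool,
        ((Σ i : Fin d, BlockVar k pos i) ↪ Fin n)), Q w.1 w.2.1 w.2.2.1 w.2.2.2) ≠ 0 := by
    by_contra h
    simp only [not_exists, not_not] at h
    exact hprod (MvPolynomial.funext fun A => by rw [map_zero, ← coe_aeval_eq_eval]; exact h A)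
  rw [map_prod] at hA
  refine ⟨MvPolynomial.mapAlgHom (σ := Fin n) (MvPolynomial.aeval A) G, ?_, ?_, ?_⟩
  · rw [hspec A]
    have hdeg1 : ∀ v : Fin n × Fin n × Fin n,
        ((∑ u : Fin n, C (A (v, some u)) * X u + C (A (v, none)) : MvPolynomial (Fin n) ℂ)).totalDegree
          ≤ 1 := fun v => totalDegree_affine_le (K := ℂ) (fun o => A (v, o))
    exact (HasDetRepr.totalDegree_aeval_le_of_le_one (k := ℂ)
      (fun v : Fin n × Fin n × Fin n =>
        ((∑ u : Fin n, C (A (v, some u)) * X u + C (A (v, none)) : MvPolynomial (Fin n) ℂ)))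
      hdeg1 (immPoly n n ℂ)).trans (immPoly_isHomogeneous_holds (k := ℂ) n n).totalDegree_le
  · rw [hspec A]
    refine (complexity_aeval_le _ _).trans (Nat.add_le_add (complexity_immPoly_le ℂ n n) ?_)
    calc ∑ v : Fin n × Fin n × Fin n, complexity
            ((∑ u : Fin n, C (A (v, some u)) * X u + C (A (v, none)) : MvPolynomial (Fin n) ℂ))
        ≤ ∑ _v : Fin n × Fin n × Fin n, (2 * n + 1) :=
          Finset.sum_le_sum fun v _ => complexity_affine_le fun o => A (v, o)
      _ = n ^ 3 * (2 * n + 1) := by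
          rw [Finset.sum_const, Finset.card_univ, smul_eq_mul, Fintype.card_prod, Fintype.card_prod,
            Fintype.card_fin]
          ring
  · intro d k pos hd hdn hk hn e
    have hw := Finset.prod_ne_zero_iff.1 hA ⟨⟨d, by omega⟩, ⟨k, by omega⟩, pos, e⟩ (Finset.mem_univ _)
    exact hQ ⟨d, by omega⟩ ⟨k, by omega⟩ pos e A hw hd hn

/-- **Membership**: for `n ≥ 5` the universal polynomial lies in `SmallCircuits ℂ n 5`
(`n + 2n⁴ + n³(2n+1) ≤ n⁵`). [cite: ForbesShpilkaVolk2018, Cor. 5] -/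
theorem exists_lstUniversal_smallCircuits {n : ℕ} (h5 : 5 ≤ n) :
    ∃ f ∈ SmallCircuits ℂ n 5,
      ∀ {d : ℕ} (k : ℕ) (pos : Fin d → Bool), 1 ≤ d → d ≤ n → k ≤ n →
        ∀ (hn : ∀ t ≤ d, 2 ^ overLen k pos t ≤ n) (e : (Σ i : Fin d, BlockVar k pos i) ↪ Fin n),
        pdRank ℂ (posBlocks pos) (negBlocks pos) (killCompl e.injective f) =
          2 ^ min (streamLen k pos true d) (streamLen k pos false d) := by
  obtain ⟨f, hdeg, hL, hfull⟩ := exists_lstUniversal n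
  refine ⟨f, ⟨hdeg, hL.trans ?_⟩, hfull⟩
  have h0 : n + 2 * n ^ 3 * n + n ^ 3 * (2 * n + 1) = n + 4 * n ^ 4 + n ^ 3 := by ring
  rw [h0]
  have h1 : 2 * n ^ 3 ≤ n ^ 4 := by
    calc 2 * n ^ 3 ≤ n * n ^ 3 := Nat.mul_le_mul_right _ (by omega)
      _ = n ^ 4 := by ring
  have h2 : n ≤ n ^ 3 := by
    calc n = n ^ 1 := (pow_one n).symm
      _ ≤ n ^ 3 := Nat.pow_le_pow_right (by omega) (by omega)
  have h3 : 5 * n ^ 4 ≤ n ^ 5 := by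
    calc 5 * n ^ 4 ≤ n * n ^ 4 := Nat.mul_le_mul_right _ h5
      _ = n ^ 5 := by ring
  linarith

/-! ## §2 The wall for UNION certificates -/

/-- **No union-type LST class condition holds on `SmallCircuits ℂ n 5`** (`n ≥ 5`): it is NOT the
case that every member of the class has SOME word datum (any `k ≤ n`, `1 ≤ d ≤ n`, sign pattern,
embedding) with deficient block rank — the universal polynomial is full for all of them at once.
[cite: LimayeSrinivasanTavenas2025, §2.2] -/
theorem not_forall_exists_pdRank_lt {n : ℕ} (h5 : 5 ≤ n) :
    ¬ ∀ f ∈ SmallCircuits ℂ n 5, ∃ (d k : ℕ) (pos : Fin d → Bool)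
        (_ : ∀ t ≤ d, 2 ^ overLen k pos t ≤ n) (e : (Σ i : Fin d, BlockVar k pos i) ↪ Fin n),
        1 ≤ d ∧ d ≤ n ∧ k ≤ n ∧
        pdRank ℂ (posBlocks pos) (negBlocks pos) (killCompl e.injective f) <
          2 ^ min (streamLen k pos true d) (streamLen k pos false d) := by
  intro h
  obtain ⟨f, hf, hfull⟩ := exists_lstUniversal_smallCircuits h5
  obtain ⟨d, k, pos, hn, e, hd, hdn, hk, hlt⟩ := h f hf
  rw [hfull k pos hd hdn hk hn e] at hlt
  exact lt_irrefl _ hlt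

/-- **FSV form for unions.**  A polynomial `D` in the coefficient variables whose zero set on
degree-`≤ n` coefficient vectors is a UNION of LST rank-deficiency loci over any family `W` of word
data (indexed by any type) is not an `IsNaturalProof` against `SmallCircuits ℂ n 5` (`n ≥ 5`), in any
distinguisher class. [cite: ForbesShpilkaVolk2018, Def. 1] -/
theorem not_isNaturalProof_of_zeroSet_union {n : ℕ} (h5 : 5 ≤ n) {ι : Type*}
    (dW kW : ι → ℕ) (posW : (i : ι) → Fin (dW i) → Bool)
    (hW : ∀ i, 1 ≤ dW i ∧ dW i ≤ n ∧ kW i ≤ n)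
    (hnW : ∀ i, ∀ t ≤ dW i, 2 ^ overLen (kW i) (posW i) t ≤ n)
    (eW : (i : ι) → (Σ j : Fin (dW i), BlockVar (kW i) (posW i) j) ↪ Fin n)
    (𝒟 : Set (MvPolynomial (degLEMonomials n) ℂ)) (D : MvPolynomial (degLEMonomials n) ℂ)
    (hD : ∀ g : MvPolynomial (Fin n) ℂ, g.totalDegree ≤ n →
      (eval (coeffVector (degLEMonomials n) g) D = 0 ↔
        ∃ i : ι, pdRank ℂ (posBlocks (posW i)) (negBlocks (posW i))
          (killCompl (eW i).injective g) <
            2 ^ min (streamLen (kW i) (posW i) true (dW i)) (streamLen (kW i) (posW i) false (dW i)))) :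
    ¬ IsNaturalProof (degLEMonomials n) (SmallCircuits ℂ n 5) 𝒟 D := by
  rintro ⟨-, -, hvan⟩
  obtain ⟨f, hf, hfull⟩ := exists_lstUniversal_smallCircuits h5
  obtain ⟨i, hlt⟩ := (hD f hf.1).1 (hvan f hf)
  obtain ⟨hd, hdn, hk⟩ := hW i
  rw [hfull (kW i) (posW i) hd hdn hk (hnW i) (eW i)] at hlt
  exact lt_irrefl _ hlt

end Universal

end ProductDepthWallUniversal

end Summit.ValiantsHypothesis.ValiantsHypothesis.Theorems.BarrierLeverDefinableEquations
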